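import Summits.Ventures.DiscreteObjects.Hadamard.Order167GSQuad668

/-!
# H(668): an automorphism of order 167 is EXACTLY a 4 × 4 array of circulant blocks of order 167 (kernel)

Framing: lottery ticket; floor = certified bounds/negative ranges.

Cell pub-namedobj (venture DiscreteObjects), target (H), hadamard gen 19.  Sharpening of `Order167GSQuad668` (order 167 ⇒ a
Goethals–Seidel quadruple = the FIRST block row): the orbit decomposition of sums (`CyclicCorePAF.exists_free_transversal`) makes the
orbit maps `(p, s) ↦ π^s x_p`, `(q, t) ↦ κ^t y_q` BIJECTIONS `Fin 4 × ZMod 167 ≃ rows / columns` (each point is hit exactly once: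
apply the sum identity to an indicator function), and reindexing the re-signed matrix along them gives
* **`exists_circulantArray_of_hadamard668_signedAut_167`**: a Hadamard matrix of order `668` with a signed automorphism of order
  `167` yields `16` sequences `x p q : ZMod 167 → ℤ` such that the block matrix `M (p, s) (q, t) = x p q (t − s)` on
  `Fin 4 × ZMod 167` — a `4 × 4` array of circulant `±1` blocks of order `167` — is a Hadamard matrix of order `668`;
* **`hadamard668_circulantArray_aut167`** (converse, trivial): such an array has the simultaneous block shift
  `(p, s) ↦ (p, s + 1)` as a permutation automorphism of pair order `167`;
* **`hadamard668_aut167_iff_circulantArray`**: *some H(668) has a signed automorphism with `167 ∣ orderOf (π, κ)` iff some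
  H(668) is a `4 × 4` array of circulant blocks of order `167`* (the '`Z₁₆₇`-type' / 16-circulant family; Williamson, Ito-type
  (quasi-Williamson) and all-circulant arrays are sub-cases, the Goethals–Seidel array with its back-circulant blocks is NOT).
The first block row of the array is a Goethals–Seidel quadruple (`Order167GSQuad668`), and every block row is.  Dictionary /
structure of a hypothetical object; no order excluded; H(668) untouched.  Classical shape (regular cyclic action ⇒ circulant
blocks, Horadam 2007 §2.3); statements ours; no `sorry`, no definitions (the array is written as a `Matrix.of` term).
-/

namespace Summit.Ventures.DiscreteObjects.Hadamard

open Finset BigOperators Matrix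

open Literature.Combinatorics.Designs.GoethalsSeidel (IsHadamardMatrix)

variable {ι : Type*} [Fintype ι] [DecidableEq ι]

/-! ### orbit maps are bijections -/

omit [Fintype ι] in
/-- From the orbit decomposition of sums: every point of `Y` is `κ^k t` for exactly one `(t, k) ∈ T × range n`. -/
lemma card_orbitMap_fibre_eq_one (κ : Equiv.Perm ι) {n : ℕ} (T Y : Finset ι)
    (hT : ∀ f : ι → ℤ, ∑ y ∈ Y, f y = ∑ t ∈ T, ∑ k ∈ Finset.range n, f ((κ ^ k) t)) {z : ι} (hz : z ∈ Y) :
    ((T ×ˢ Finset.range n).filter fun q : ι × ℕ => (κ ^ q.2) q.1 = z).card = 1 := by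
  have h := hT (fun y => if y = z then 1 else 0)
  rw [Finset.sum_ite_eq' Y z, if_pos hz] at h
  rw [← Finset.sum_product' (f := fun t k => if (κ ^ k) t = z then (1 : ℤ) else 0)] at h
  rw [Finset.sum_boole] at h
  exact_mod_cast h.symm

omit [Fintype ι] in
/-- uniqueness form: two orbit-map preimages of the same point coincide -/
lemma orbitMap_unique (κ : Equiv.Perm ι) {n : ℕ} (T Y : Finset ι)
    (hT : ∀ f : ι → ℤ, ∑ y ∈ Y, f y = ∑ t ∈ T, ∑ k ∈ Finset.range n, f ((κ ^ k) t))
    {t t' : ι} (ht : t ∈ T) (ht' : t' ∈ T) {k k' : ℕ} (hk : k < n) (hk' : k' < n)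
    (hY : (κ ^ k) t ∈ Y) (heq : (κ ^ k) t = (κ ^ k') t') : t = t' ∧ k = k' := by
  have h1 := card_orbitMap_fibre_eq_one κ T Y hT hY
  obtain ⟨q₀, hq₀⟩ := Finset.card_eq_one.mp h1
  have hm : (t, k) ∈ (T ×ˢ Finset.range n).filter fun q : ι × ℕ => (κ ^ q.2) q.1 = (κ ^ k) t :=
    Finset.mem_filter.mpr ⟨Finset.mem_product.mpr ⟨ht, Finset.mem_range.mpr hk⟩, rfl⟩
  have hm' : (t', k') ∈ (T ×ˢ Finset.range n).filter fun q : ι × ℕ => (κ ^ q.2) q.1 = (κ ^ k) t :=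
    Finset.mem_filter.mpr ⟨Finset.mem_product.mpr ⟨ht', Finset.mem_range.mpr hk'⟩, heq.symm⟩
  rw [hq₀, Finset.mem_singleton] at hm hm'
  have e := hm.trans hm'.symm
  exact ⟨congrArg Prod.fst e, congrArg Prod.snd e⟩

/-- **Orbit coordinates.**  If ALL points are listed by the `κ`-cycles of length `167` of a `4`-element transversal `T`, the orbit
map `Fin 4 × ZMod 167 → ι`, `(p, s) ↦ κ^s (e p)`, is a bijection. -/
lemma orbitMap_bijective (κ : Equiv.Perm ι) (hι : Fintype.card ι = 668) (T : Finset ι)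
    (hT : ∀ f : ι → ℤ, ∑ y ∈ (univ : Finset ι), f y = ∑ t ∈ T, ∑ k ∈ Finset.range 167, f ((κ ^ k) t))
    (e4 : Fin 4 ≃ {t // t ∈ T}) :
    Function.Bijective (fun a : Fin 4 × ZMod 167 => (κ ^ a.2.val) (e4 a.1).1) := by
  rw [Fintype.bijective_iff_injective_and_card]
  refine ⟨fun a b hab => ?_, by simp [ZMod.card, hι]⟩
  obtain ⟨h1, h2⟩ := orbitMap_unique κ T univ hT (e4 a.1).2 (e4 b.1).2 (ZMod.val_lt a.2) (ZMod.val_lt b.2)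
    (Finset.mem_univ _) hab
  exact Prod.ext (e4.injective (Subtype.ext h1)) (ZMod.val_injective 167 h2)

/-! ### order 167 ⇒ a 4 × 4 array of circulant blocks -/

/-- **Order 167 ⇒ `16` circulant blocks.**  A Hadamard matrix of order `668` with a signed automorphism `(π, κ, d, e)`,
`π^167 = κ^167 = 1`, `(π, κ) ≠ (1,1)`, yields `x : Fin 4 → Fin 4 → ZMod 167 → ℤ` such that the `4 × 4` array of circulant blocks
`M (p, s) (q, t) = x p q (t − s)` is a Hadamard matrix of order `668` (on `Fin 4 × ZMod 167`). -/
theorem exists_circulantArray_of_hadamard668_signedAut_167 {H : Matrix ι ι ℤ} (hH : IsHadamardMatrix H)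
    (hι : Fintype.card ι = 668) {π κ : Equiv.Perm ι} {d e : ι → ℤ} (haut : IsSignedAut H π κ d e)
    (hπ : π ^ 167 = 1) (hκ : κ ^ 167 = 1) (hne : π ≠ 1 ∨ κ ≠ 1) :
    ∃ x : Fin 4 → Fin 4 → ZMod 167 → ℤ,
      IsHadamardMatrix (Matrix.of fun (a b : Fin 4 × ZMod 167) => x a.1 b.1 (b.2 - a.2)) ∧
      Fintype.card (Fin 4 × ZMod 167) = 668 := by
  have h167 := hadamard668_fixedRows_167 hH hι π κ d e haut hπ hκ hne
  have hπfix : ∀ x, π x ≠ x := moved_of_card_fixed_eq_zero π h167.1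
  have hκfix : ∀ y, κ y ≠ y := moved_of_card_fixed_eq_zero κ h167.2.1
  have p167 : Nat.Prime 167 := by norm_num
  -- re-sign
  obtain ⟨σ, τ, -, -, hH', hinv⟩ := exists_resign_of_odd hH haut (by decide : Odd 167) hπ hκ
  set H' : Matrix ι ι ℤ := Matrix.of fun i j => σ i * τ j * H i j with hH'def
  have hinv' : ∀ i j, H' (π i) (κ j) = H' i j := fun i j => by
    simp only [hH'def, Matrix.of_apply]; exact hinv i j
  -- transversals of rows and of columns (all points free of period 167)
  have htr : ∀ ρ : Equiv.Perm ι, ρ ^ 167 = 1 → (∀ x, ρ x ≠ x) →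
      ∃ T : Finset ι, T.card = 4 ∧
        ∀ f : ι → ℤ, ∑ y ∈ (univ : Finset ι), f y = ∑ t ∈ T, ∑ k ∈ Finset.range 167, f ((ρ ^ k) t) := by
    intro ρ hρ hfix
    have hfree : ∀ y ∈ (univ : Finset ι), ∀ k, 0 < k → k < 167 → (ρ ^ k) y ≠ y :=
      fun y _ => free_of_fixed_prime_pow ρ p167 (by rw [hρ, Equiv.Perm.one_apply]) (hfix y)
    obtain ⟨T, -, hTc, hTs⟩ := exists_free_transversal ρ (by norm_num : 0 < 167) _ univ le_rfl
      (fun y _ => Finset.mem_univ _) (fun y _ => by rw [hρ, Equiv.Perm.one_apply]) hfree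
    rw [Finset.card_univ, hι] at hTc
    exact ⟨T, by omega, hTs⟩
  obtain ⟨TR, hTR4, hTRs⟩ := htr π hπ hπfix
  obtain ⟨TC, hTC4, hTCs⟩ := htr κ hκ hκfix
  let eR4 : Fin 4 ≃ {t // t ∈ TR} := (Finset.equivFinOfCardEq hTR4).symm
  let eC4 : Fin 4 ≃ {t // t ∈ TC} := (Finset.equivFinOfCardEq hTC4).symm
  let fR : Fin 4 × ZMod 167 → ι := fun a => (π ^ a.2.val) (eR4 a.1).1
  let fC : Fin 4 × ZMod 167 → ι := fun a => (κ ^ a.2.val) (eC4 a.1).1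
  have hbR : Function.Bijective fR := orbitMap_bijective π hι TR hTRs eR4
  have hbC : Function.Bijective fC := orbitMap_bijective κ hι TC hTCs eC4
  let ER : Fin 4 × ZMod 167 ≃ ι := Equiv.ofBijective fR hbR
  let EC : Fin 4 × ZMod 167 ≃ ι := Equiv.ofBijective fC hbC
  -- the 16 sequences
  refine ⟨fun p q r => H' (eR4 p).1 ((κ ^ r.val) (eC4 q).1), ?_, by simp [ZMod.card]⟩
  -- the array is the reindexed H'
  have hentry : ∀ a b : Fin 4 × ZMod 167,
      H' (eR4 a.1).1 ((κ ^ (b.2 - a.2).val) (eC4 b.1).1) = H' (ER a) (EC b) := by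
    intro a b
    show H' (eR4 a.1).1 ((κ ^ (b.2 - a.2).val) (eC4 b.1).1) = H' ((π ^ a.2.val) (eR4 a.1).1) ((κ ^ b.2.val) (eC4 b.1).1)
    have e1 : (κ ^ b.2.val) (eC4 b.1).1 = (κ ^ a.2.val) ((κ ^ (b.2 - a.2).val) (eC4 b.1).1) := by
      rw [← Equiv.Perm.mul_apply, ← pow_add, ← pow_mod_of_pow_eq_one κ hκ (a.2.val + (b.2 - a.2).val), ← ZMod.val_add,
        add_sub_cancel]
    rw [e1, perm_aut_pow hinv' a.2.val]
  have hM : (Matrix.of fun (a b : Fin 4 × ZMod 167) => H' (eR4 a.1).1 ((κ ^ (b.2 - a.2).val) (eC4 b.1).1)) =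
      H'.submatrix ER EC := by
    ext a b
    rw [Matrix.of_apply, Matrix.submatrix_apply, hentry]
  rw [hM]
  refine ⟨fun a b => hH'.1 _ _, ?_⟩
  rw [Matrix.transpose_submatrix, Matrix.submatrix_mul_equiv, hH'.2]
  ext a b
  rw [Matrix.submatrix_apply, Matrix.smul_apply, Matrix.one_apply, Matrix.smul_apply, Matrix.one_apply, hι]
  simp only [EmbeddingLike.apply_eq_iff_eq]
  simp [ZMod.card]

/-! ### the converse and the dictionary statement -/

/-- **A `4 × 4` array of circulant blocks of order 167 has the block shift as an automorphism of pair order `167`.** -/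
theorem hadamard668_circulantArray_aut167 (x : Fin 4 → Fin 4 → ZMod 167 → ℤ)
    (hM : IsHadamardMatrix (Matrix.of fun (a b : Fin 4 × ZMod 167) => x a.1 b.1 (b.2 - a.2))) :
    IsSignedAut (Matrix.of fun (a b : Fin 4 × ZMod 167) => x a.1 b.1 (b.2 - a.2))
        (Equiv.prodCongr (Equiv.refl (Fin 4)) (Equiv.addRight (1 : ZMod 167)))
        (Equiv.prodCongr (Equiv.refl (Fin 4)) (Equiv.addRight (1 : ZMod 167))) (fun _ => 1) (fun _ => 1) ∧
      Fintype.card (Fin 4 × ZMod 167) = 668 ∧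
      orderOf ((Equiv.prodCongr (Equiv.refl (Fin 4)) (Equiv.addRight (1 : ZMod 167)),
                Equiv.prodCongr (Equiv.refl (Fin 4)) (Equiv.addRight (1 : ZMod 167))) :
        Equiv.Perm (Fin 4 × ZMod 167) × Equiv.Perm (Fin 4 × ZMod 167)) = 167 := by
  have _ := hM
  set σ : Equiv.Perm (Fin 4 × ZMod 167) := Equiv.prodCongr (Equiv.refl (Fin 4)) (Equiv.addRight (1 : ZMod 167)) with hσ
  have hσapp : ∀ k : ℕ, ∀ a : Fin 4 × ZMod 167, (σ ^ k) a = (a.1, a.2 + k) := by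
    intro k
    induction k with
    | zero => intro a; simp
    | succ k ih =>
      intro a
      rw [pow_succ', Equiv.Perm.mul_apply, ih]
      simp only [hσ, Equiv.prodCongr_apply, Equiv.coe_refl, Prod.map_apply, id_eq, Equiv.coe_addRight]
      push_cast
      rw [add_assoc]
  refine ⟨⟨fun _ => Or.inl rfl, fun _ => Or.inl rfl, fun a b => ?_⟩, by simp [ZMod.card], ?_⟩
  · simp [hσ]
  · haveI : Fact (Nat.Prime 167) := ⟨by norm_num⟩
    apply orderOf_eq_prime
    · rw [Prod.pow_mk, Prod.mk_eq_one]
      have h1 : σ ^ 167 = 1 := by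
        ext a
        · rw [hσapp]; rfl
        · rw [hσapp, Equiv.Perm.one_apply, ZMod.natCast_self, add_zero]
      exact ⟨h1, h1⟩
    · intro h
      have h1 : σ = 1 := (Prod.mk_eq_one.mp h).1
      have := congrArg (fun ρ : Equiv.Perm (Fin 4 × ZMod 167) => (ρ ((0 : Fin 4), (0 : ZMod 167))).2) h1
      simp [hσ] at this

/-- **The dictionary, order 167.**  *Some Hadamard matrix of order `668` has a signed automorphism whose permutation pair has
order divisible by `167`* **iff** *some Hadamard matrix of order `668` is a `4 × 4` array of circulant `±1` blocks of order
`167`.* -/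
theorem hadamard668_aut167_iff_circulantArray :
    (∃ (ι : Type) (_ : Fintype ι) (_ : DecidableEq ι) (H : Matrix ι ι ℤ) (π κ : Equiv.Perm ι) (d e : ι → ℤ),
        Fintype.card ι = 668 ∧ IsHadamardMatrix H ∧ IsSignedAut H π κ d e ∧
        167 ∣ orderOf ((π, κ) : Equiv.Perm ι × Equiv.Perm ι)) ↔
    ∃ x : Fin 4 → Fin 4 → ZMod 167 → ℤ,
      IsHadamardMatrix (Matrix.of fun (a b : Fin 4 × ZMod 167) => x a.1 b.1 (b.2 - a.2)) := by
  constructor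
  · rintro ⟨ι, _, _, H, π, κ, d, e, hι, hH, haut, hdvd⟩
    set g : Equiv.Perm ι × Equiv.Perm ι := (π, κ) with hg
    have hg0 : orderOf g ≠ 0 := (orderOf_pos g).ne'
    set k := orderOf g / 167 with hk
    have hord : orderOf (g ^ k) = 167 := orderOf_pow_orderOf_div hg0 hdvd
    have hgk : g ^ k = ((π ^ k, κ ^ k) : Equiv.Perm ι × Equiv.Perm ι) := by rw [hg, Prod.pow_mk]
    rw [hgk] at hord
    obtain ⟨h1, h2, h3⟩ := pow_data_of_orderOf hord (a := 1) Nat.one_pos (by norm_num)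
    rw [pow_one, pow_one] at h3
    obtain ⟨x, hx, -⟩ := exists_circulantArray_of_hadamard668_signedAut_167 hH hι (isSignedAut_pow haut k) h1 h2 h3
    exact ⟨x, hx⟩
  · rintro ⟨x, hx⟩
    obtain ⟨haut, hcard, hord⟩ := hadamard668_circulantArray_aut167 x hx
    exact ⟨Fin 4 × ZMod 167, inferInstance, inferInstance, _, _, _, _, _, hcard, hx, haut, by rw [hord]⟩

end Summit.Ventures.DiscreteObjects.Hadamard
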